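import Summits.QuantumFields.YangMills.Theorems.UnitScaleTiltSmoothLiftLoopConsistency
import Summits.QuantumFields.YangMills.Theorems.UnitScaleTiltSmoothLiftStructure
import Summits.QuantumFields.YangMills.Theorems.UnitScaleTiltSmoothLiftInterpGrad
import Summits.QuantumFields.YangMills.Theorems.UnitScaleTiltSmoothLiftRough
import Summits.QuantumFields.YangMills.Theorems.UnitScaleTiltBlockAvgCorrector
import Literature.MathematicalPhysics.QuantumFieldTheory.Balaban1983to89.TorusGeometry
import Literature.MathematicalPhysics.QuantumFieldTheory.Balaban1983to89.T3PrintedMinimiserExistence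
import HarnessLib

/-!
# Route `UnitScaleTilt`, crux K1 child «MinimiserStabilityRegPr» (stmt-QuantumFields-19200): THE REGISTERED STUB `stub_smoothLift`
# (located gap G-K1a-2′, schema `T3UpperLiftSplit.SmoothLiftAt`) PROVED — smooth exact one-step lifts through Bałaban's averaging (0.4)

Fleet seat `ym-ust-19200-p2` (gen 0).  `SmoothLiftAt L C₁ C₂ c`: every `SU(2)` field `U` on the finest lattice of run `K` of a member of the
`d = 3` family with block size `L`, with plaquettes `< a` and curvature gradients `≤ b` (`a, b ≤ c`), has an EXACT lift `U″` through one (0.4)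
averaging with the printed exp-mean-log operation (`D_{K,K+1}U″ = U`), plaquettes `< C₁(a+b)`, gradients `≤ C₁(b+a²)`, and
`L·A(U″) ≤ A(U) + C₂(b² + ab + a³)·L^{3(m+K)}`.

THE PROOF (all pieces are tree theorems of this seat's helper files and of the cell):
* the ROUGH regime `a ≤ b` is the face section (`SmoothLift.smoothLiftAt_of_smooth`, p441624), so only `b < a ≤ c` is needed;
* read `U` as a level-1 field `V` of the `(K+1)`-th tower (`fieldShift`; one descent step is one (0.4) averaging, `descendTo_succ`); its
  ordered plaquettes are within `a` of `1` and its log-curvature `F = log V(∂p)` is covariantly constant up to `b′ = (3/2)b`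
  ([Balaban1985RegularSpaces] (1.1) read through `AvgCurvGrad.covDerivT_plaqFT_shift_eq`, Lipschitz logarithm);
* the SMOOTH INTERPOLATION `W = interp V` (`UnitScaleTiltSmoothLiftInterpDefs`: block-centred symmetric-gauge model `exp(s·B_λ)·faceSec V`)
  has every fine plaquette within `K = 2(14a)² + 9b′` of `exp(F(y)/L²)` (`…InterpPlaq`), hence carries `1/L` of the action up to
  `O(a³ + aK + K²)` per coarse plaquette (`…SmoothLiftStructure`, from the block structure alone), has gradients `O(K + a² + b′)` (`…InterpGrad`), and its
  (0.4)-average is within `η = 2(3(15La)² + 9b′)` of `V` (`…LoopConsistency`);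
* the EXACT CORRECTOR of the cell (`BlockAvgCorrector.exists_corrector_T3`, p-ym3: Banach fixed point in the private central-bond coordinates)
  moves only the central crossing bonds, each by `≤ Cη`, after which `Ū″ = V` exactly; the block structure survives with `K ↦ K + 4Cη`,
  `ε ↦ 6a + Cη`, so clauses (ii)–(iv) follow with constants polynomial in `L` and `C`, and (i) is `descendTo_succ` + `fieldShift_fieldShift`.
Constants: `c = min(1/(1400L²), t₀/D)` with the corrector's radius `t₀`, `D = 500 + 1400CL²`. NOT PRINTED for non-abelian fields (abelian
template [King1986] (A.5)); nothing of Bałaban's is asserted. [cite: King1986, (A.5) p.676; Balaban1987RG1, (0.4) p.253;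
Balaban1985RegularSpaces, (1.1) p.76]
-/

noncomputable section

open scoped BigOperators Matrix.Norms.L2Operator

namespace Summit.QuantumFields.YangMills.Theorems.SmoothLift

open Literature.MathematicalPhysics.QuantumFieldTheory.Balaban1983to89
open NormedSpace MatrixLog T4Continuum BlockAveraging AveragingRT ExpMeanLog BlockAveragingSection BlockAveragingSectionPlaq
open B10Eq27TorusAxialLog (toUField unitsField)
open B10Eq68TorusRegularity (plaqFT covDerivT)
open T3ContinuumYM3Torus T3LevelShift T3TiltDescent T3UpperLiftSplit T3OneStepAveragingPlaquettes
open T3UnitLawDensityEML (ℰp)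
open T3PrintedMinimiserExistence (plaqSmall_of_le)
open Summit.QuantumFields.YangMills.Theorems.SmoothLiftInterp
open Summit.QuantumFields.YangMills.Theorems.SmoothLiftFibre (exp_sub_one_le_two_mul norm_coe_su2_le)
open Summit.QuantumFields.YangMills.Theorems.AvgCurvGrad (covDerivT_plaqFT_shift_eq covDerivT_plaqFT_fieldShift)
open Summit.QuantumFields.YangMills.Theorems.BlockAvgCorrector (exists_corrector_T3 norm_plaqHol_sub_plaqHol_le)

/-! ## §3 One lift: interpolate, then correct -/

section Lift

/-- The numerical smallness facts used by the raw lift (`L ≥ 3`, `0 ≤ b ≤ a ≤ 1/(1400L²)`, `(500 + 1400CL²)a ≤ t₀`). [folklore] -/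
theorem lift_smallness {L C a b t₀ : ℝ} (hL3 : 3 ≤ L) (hC : 0 ≤ C) (hb : 0 ≤ b) (hba : b ≤ a) (ha : a ≤ 1 / (1400 * L ^ 2))
    (hat : (500 + 1400 * C * L ^ 2) * a ≤ t₀) :
    a ≤ 1 / 1400 ∧ (3 + 2) * L * 3 * a ≤ 1 / 8 ∧ 3 * ((3 + 2) * L * 3 * a) ^ 2 + 3 ^ 2 * (3 / 2 * b) ≤ 1 / 2 ∧
      5 * a + (392 * a ^ 2 + 27 / 2 * b) + C * (1350 * L ^ 2 * a ^ 2 + 27 * b) ≤ t₀ ∧ 1 / L ^ 2 ≤ 1 := by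
  have hL0 : 0 < L := by linarith
  have ha0 : 0 ≤ a := hb.trans hba
  have hL2 : 1 ≤ L ^ 2 := by nlinarith
  have haL : a * L ^ 2 ≤ 1 / 1400 := by
    have h := ha; rw [le_div_iff₀ (by positivity)] at h; linarith
  have ha1400 : a ≤ 1 / 1400 := by nlinarith [mul_le_mul_of_nonneg_left hL2 ha0]
  have haLa : L ^ 2 * a ^ 2 ≤ a / 1400 := by nlinarith [mul_le_mul_of_nonneg_left haL ha0]
  have haL1 : a * L ≤ 1 / 4200 := by nlinarith [mul_le_mul_of_nonneg_left hL3 (mul_nonneg ha0 hL0.le)]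
  refine ⟨ha1400, by nlinarith, by nlinarith, ?_, (div_le_one (by positivity)).mpr hL2⟩
  have h2 : 1350 * L ^ 2 * a ^ 2 + 27 * b ≤ 28 * a := by nlinarith
  have h3 : C * (1350 * L ^ 2 * a ^ 2 + 27 * b) ≤ C * (28 * a) := mul_le_mul_of_nonneg_left h2 hC
  have h4 : C * (28 * a) ≤ 1400 * C * L ^ 2 * a := by
    have := mul_le_mul_of_nonneg_left hL2 (mul_nonneg hC ha0)
    nlinarith
  nlinarith

/-- The numerical facts relating the stub's radius `c = min(1/(1400(L²+1)), t₀/(500 + 1400C(L²+1)))` to the raw lift's hypotheses. [folklore] -/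
theorem stub_smallness {L C a t₀ : ℝ} (hL1 : 1 ≤ L) (hC : 0 ≤ C) (ha0 : 0 ≤ a)
    (hac : a ≤ min (1 / (1400 * (L ^ 2 + 1))) (t₀ / (500 + 1400 * C * (L ^ 2 + 1)))) :
    a ≤ 1 / (1400 * L ^ 2) ∧ a ≤ 1 / 1400 ∧ (500 + 1400 * C * L ^ 2) * a ≤ t₀ := by
  have hD0 : (0 : ℝ) < 500 + 1400 * C * (L ^ 2 + 1) := by positivity
  have ha : a ≤ 1 / (1400 * L ^ 2) :=
    (hac.trans (min_le_left _ _)).trans (one_div_le_one_div_of_le (by positivity) (by nlinarith))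
  refine ⟨ha, ha.trans (one_div_le_one_div_of_le (by norm_num) (by nlinarith)), ?_⟩
  have h1 : a ≤ t₀ / (500 + 1400 * C * (L ^ 2 + 1)) := hac.trans (min_le_right _ _)
  rw [le_div_iff₀ hD0] at h1
  nlinarith [mul_nonneg hC ha0]

/-- **THE SMOOTH EXACT LIFT, RAW FORM.**  For a member `F` of the family, a run `K`, the corrector's data `(t₀, C)` at block size `F.L`, and
`0 ≤ b ≤ a` with `a ≤ 1/(1400L²)` and `(500 + 1400CL²)a ≤ t₀`: every `a`-small `U` with curvature gradients `≤ b` has an exact one-step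
lift `U″` with plaquettes `< 5a + K₀ + 4Cη`, gradients `≤ 2(K₀ + 4Cη) + 8a(6a + Cη) + (9/2)b`, and
`L·A(U″) ≤ A(U) + 24L^{3(m+K)}·(16a³ + 2aL²K′ + (4a² + L²K′)²)`, where `K₀ = 392a² + (27/2)b`, `η = 1350L²a² + 27b`, `K′ = K₀ + 4Cη`.
[cite: King1986, (A.5) p.676] -/
theorem exists_lift_raw (F : T3Family) (K : ℕ) {t₀ C : ℝ} (hC : 0 ≤ C)
    (hcor : ∀ (j : ℕ), j + 1 ≤ F.m + (K + 1) → ∀ (t η : ℝ), 0 ≤ t → 0 ≤ η → t + C * η ≤ t₀ →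
      ∀ W : GaugeField (F.P (K + 1)) j (Matrix.specialUnitaryGroup (Fin 2) ℂ), PlaqSmall t W →
        ∀ V : GaugeField (F.P (K + 1)) (j + 1) (Matrix.specialUnitaryGroup (Fin 2) ℂ),
          (∀ c, ‖((V c : Matrix.specialUnitaryGroup (Fin 2) ℂ) : Matrix (Fin 2) (Fin 2) ℂ) -
            ((avgFun ℰp W c : Matrix.specialUnitaryGroup (Fin 2) ℂ) : Matrix (Fin 2) (Fin 2) ℂ)‖ ≤ η) →
          ∃ U' : GaugeField (F.P (K + 1)) j (Matrix.specialUnitaryGroup (Fin 2) ℂ),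
            avgFun ℰp U' = V ∧ (∀ b, (∀ c, BlockAveragingHaarAC.centralBond c ≠ b) → U' b = W b) ∧
            (∀ b, ‖((U' b : Matrix.specialUnitaryGroup (Fin 2) ℂ) : Matrix (Fin 2) (Fin 2) ℂ) - (W b : Matrix (Fin 2) (Fin 2) ℂ)‖ ≤ C * η) ∧
            PlaqSmall (t + 4 * (C * η)) U')
    {a b : ℝ} (hb : 0 ≤ b) (hba : b ≤ a) (hapos : 0 < a) (ha : a ≤ 1 / (1400 * (F.L : ℝ) ^ 2))
    (hat : (500 + 1400 * C * (F.L : ℝ) ^ 2) * a ≤ t₀)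
    (U : GaugeField (F.P K) 0 (Matrix.specialUnitaryGroup (Fin 2) ℂ)) (hU : PlaqSmall a U)
    (hgrad : ∀ (x : Site (F.P K) 0) (ν κ κ' : Fin (F.P K).d), κ ≠ κ' →
      ‖covDerivT 1 (unitsField (toUField U)) ν (plaqFT (unitsField (toUField U)) κ κ') x‖ ≤ b) :
    ∃ U'' : GaugeField (F.P (K + 1)) 0 (Matrix.specialUnitaryGroup (Fin 2) ℂ),
      descendTo F ℰp K (K + 1) (Nat.le_succ K) U'' = U ∧
      PlaqSmall (5 * a + (392 * a ^ 2 + 27 / 2 * b) + 4 * (C * (1350 * (F.L : ℝ) ^ 2 * a ^ 2 + 27 * b))) U'' ∧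
      (∀ (x : Site (F.P (K + 1)) 0) (ν κ κ' : Fin (F.P (K + 1)).d), κ ≠ κ' →
        ‖covDerivT 1 (unitsField (toUField U'')) ν (plaqFT (unitsField (toUField U'')) κ κ') x‖ ≤
          2 * ((392 * a ^ 2 + 27 / 2 * b) + 4 * (C * (1350 * (F.L : ℝ) ^ 2 * a ^ 2 + 27 * b))) +
            8 * a * (6 * a + C * (1350 * (F.L : ℝ) ^ 2 * a ^ 2 + 27 * b)) + 3 * (3 / 2 * b)) ∧
      (F.L : ℝ) * wilsonAction4 U'' ≤ wilsonAction4 U + 24 * (F.L : ℝ) ^ (3 * (F.m + K)) *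
        (16 * a ^ 3 + 2 * a * (F.L : ℝ) ^ 2 * ((392 * a ^ 2 + 27 / 2 * b) + 4 * (C * (1350 * (F.L : ℝ) ^ 2 * a ^ 2 + 27 * b))) +
          (4 * a ^ 2 + (F.L : ℝ) ^ 2 * ((392 * a ^ 2 + 27 / 2 * b) + 4 * (C * (1350 * (F.L : ℝ) ^ 2 * a ^ 2 + 27 * b)))) ^ 2) := by
  letI : NormedAlgebra ℚ (Matrix (Fin 2) (Fin 2) ℂ) := NormedAlgebra.restrictScalars ℚ ℂ _
  -- the parameters of the tower
  have hL3 : (3 : ℝ) ≤ F.L := by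
    have h1 := F.hL.2; obtain ⟨k, hk⟩ := F.hL.1
    have : 3 ≤ F.L := by omega
    exact_mod_cast this
  have hL1 : (1 : ℝ) ≤ F.L := by linarith
  have hL0 : (0 : ℝ) < F.L := by linarith
  have hd : ((F.P (K + 1)).d : ℝ) = 3 := by
    show (((F.PP F.m (K + 1)).d : ℕ) : ℝ) = 3; rw [T3Family.PP_d]; norm_num
  have hPL : ((F.P (K + 1)).L : ℝ) = F.L := by rfl
  have hj : 0 + 1 ≤ (F.P (K + 1)).m + (F.P (K + 1)).K := by show 0 + 1 ≤ F.m + (K + 1); omega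
  -- sizes
  have ha0 : 0 ≤ a := hb.trans hba
  obtain ⟨ha1400, hT', hρ', hsum', hL2inv⟩ := lift_smallness hL3 hC hb hba ha hat
  -- the coarse field at level 1 of the `(K+1)`-th tower
  have h10 : (F.PP F.m (K + 1)).sitesPerDir 1 = (F.PP F.m K).sitesPerDir 0 := F.sitesPerDir_eq (by omega)
  set V : GaugeField (F.P (K + 1)) 1 (Matrix.specialUnitaryGroup (Fin 2) ℂ) := fieldShift h10 U with hV
  have hVp : ∀ p : Plaq (F.P (K + 1)) 1, dist1 (GaugeField.plaqHol V p) ≤ a := fun p =>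
    (congrArg dist1 (plaqHol_fieldShift h10 U p)).le.trans (hU _).le
  have hgradV : ∀ (x : Site (F.P (K + 1)) 1) (ν κ κ' : Fin (F.P (K + 1)).d), κ ≠ κ' →
      ‖covDerivT 1 (unitsField (toUField V)) ν (plaqFT (unitsField (toUField V)) κ κ') x‖ ≤ b := fun x ν κ κ' hκ =>
    (congrArg norm (covDerivT_plaqFT_fieldShift h10 U ν κ κ' x)).le.trans (hgrad _ ν κ κ' hκ)
  have hV' := norm_plaqElt_sub_one_le V ha0 hVp
  have hcc := norm_conj_curv_sub_curv_le V ha0 (by linarith) hb hVp hgradV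
  have hb' : (0 : ℝ) ≤ 3 / 2 * b := by positivity
  have hc2 : ∀ (y : Site (F.P (K + 1)) 1) (ρ μ : Fin (F.P (K + 1)).d), ‖curv V y ρ μ‖ ≤ 2 * a := fun y ρ μ =>
    (norm_curv_le V y ρ μ).trans (by linarith [hV' y ρ μ])
  -- the interpolation and its structure
  set W : GaugeField (F.P (K + 1)) 0 (Matrix.specialUnitaryGroup (Fin 2) ℂ) := interp V with hW
  have ha1 : (4 * ((F.P (K + 1)).d : ℝ) + 2) * a ≤ 1 := by rw [hd]; linarith
  set K₀ : ℝ := 392 * a ^ 2 + 27 / 2 * b with hK₀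
  have hK₀eq : 2 * ((4 * ((F.P (K + 1)).d : ℝ) + 2) * a) ^ 2 + 3 * ((F.P (K + 1)).d : ℝ) * (3 / 2 * b) = K₀ := by rw [hd, hK₀]; ring
  have hK₀0 : 0 ≤ K₀ := by positivity
  have hS : ∀ q : Plaq (F.P (K + 1)) 0, ‖((GaugeField.plaqHol W q : Matrix.specialUnitaryGroup (Fin 2) ℂ) : Matrix (Fin 2) (Fin 2) ℂ) -
      exp ((1 / ((F.P (K + 1)).L : ℝ) ^ 2) • curv V (blockOf q.src) q.μ q.ν)‖ ≤ K₀ := fun q => by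
    rw [← hK₀eq]; exact norm_plaqHol_interp_sub_exp_le hj V ha0 hb' ha1 hV' hcc q
  set t : ℝ := 5 * a + K₀ with ht
  have htW : PlaqSmall t W := fun q => by
    have hSq := hS q
    set Y : Matrix (Fin 2) (Fin 2) ℂ := (1 / ((F.P (K + 1)).L : ℝ) ^ 2) • curv V (blockOf q.src) q.μ q.ν with hY
    have hYn : ‖Y‖ ≤ 2 * a := by
      rw [hY, norm_smul, Real.norm_of_nonneg (by positivity), hPL]
      calc 1 / (F.L : ℝ) ^ 2 * ‖curv V (blockOf q.src) q.μ q.ν‖ ≤ 1 * (2 * a) :=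
            mul_le_mul hL2inv (hc2 _ _ _) (norm_nonneg _) (by norm_num)
        _ = 2 * a := one_mul _
    have hexp : ‖exp Y - 1‖ ≤ 4 * a :=
      (Literature.Analysis.Calculus.norm_exp_sub_one_le Y).trans
        ((exp_sub_one_le_two_mul (norm_nonneg _) (hYn.trans (by linarith))).trans (by linarith))
    have hdq : dist1 (GaugeField.plaqHol W q) =
        ‖((GaugeField.plaqHol W q : Matrix.specialUnitaryGroup (Fin 2) ℂ) : Matrix (Fin 2) (Fin 2) ℂ) - 1‖ := rfl
    rw [hdq, show ((GaugeField.plaqHol W q : Matrix.specialUnitaryGroup (Fin 2) ℂ) : Matrix (Fin 2) (Fin 2) ℂ) - 1 =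
      (((GaugeField.plaqHol W q : Matrix.specialUnitaryGroup (Fin 2) ℂ) : Matrix (Fin 2) (Fin 2) ℂ) - exp Y) + (exp Y - 1) by abel]
    calc _ ≤ ‖((GaugeField.plaqHol W q : Matrix.specialUnitaryGroup (Fin 2) ℂ) : Matrix (Fin 2) (Fin 2) ℂ) - exp Y‖ + ‖exp Y - 1‖ :=
          norm_add_le _ _
      _ ≤ K₀ + 4 * a := add_le_add hSq hexp
      _ < t := by rw [ht]; linarith
  -- the consistency
  set η : ℝ := 1350 * (F.L : ℝ) ^ 2 * a ^ 2 + 27 * b with hη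
  have hT : (((F.P (K + 1)).d : ℝ) + 2) * ((F.P (K + 1)).L : ℝ) * ((F.P (K + 1)).d : ℝ) * a ≤ 1 / 8 := by
    rw [hd, hPL]; exact hT'
  have hρ : 3 * ((((F.P (K + 1)).d : ℝ) + 2) * ((F.P (K + 1)).L : ℝ) * ((F.P (K + 1)).d : ℝ) * a) ^ 2 +
      ((F.P (K + 1)).d : ℝ) ^ 2 * (3 / 2 * b) ≤ 1 / 2 := by
    rw [hd, hPL]; exact hρ'
  have hcons : ∀ c, ‖((V c : Matrix.specialUnitaryGroup (Fin 2) ℂ) : Matrix (Fin 2) (Fin 2) ℂ) -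
      ((avgFun ℰp W c : Matrix.specialUnitaryGroup (Fin 2) ℂ) : Matrix (Fin 2) (Fin 2) ℂ)‖ ≤ η := fun c => by
    have h := norm_sub_avgFun_interp_le hj V hV' hcc hT hρ c
    rw [hd, hPL] at h
    calc _ ≤ 2 * (3 * ((3 + 2) * (F.L : ℝ) * 3 * a) ^ 2 + 3 ^ 2 * (3 / 2 * b)) := h
      _ = η := by rw [hη]; ring
  -- the corrector
  have ht0 : 0 ≤ t := by positivity
  have hη0 : 0 ≤ η := by positivity
  have hsum : t + C * η ≤ t₀ := by rw [ht, hK₀, hη]; exact hsum'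
  obtain ⟨U', h1, -, h3, h4⟩ := hcor 0 hj t η ht0 hη0 hsum W htW V hcons
  -- the block structure of the corrected field
  have hK' : 0 ≤ K₀ + 4 * (C * η) := by positivity
  have hS' : ∀ q : Plaq (F.P (K + 1)) 0, ‖((GaugeField.plaqHol U' q : Matrix.specialUnitaryGroup (Fin 2) ℂ) : Matrix (Fin 2) (Fin 2) ℂ) -
      exp ((1 / ((F.P (K + 1)).L : ℝ) ^ 2) • curv V (blockOf q.src) q.μ q.ν)‖ ≤ K₀ + 4 * (C * η) := fun q => by
    have hA := norm_plaqHol_sub_plaqHol_le h3 q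
    have hB := hS q
    calc _ = ‖(((GaugeField.plaqHol U' q : Matrix.specialUnitaryGroup (Fin 2) ℂ) : Matrix (Fin 2) (Fin 2) ℂ) -
            ((GaugeField.plaqHol W q : Matrix.specialUnitaryGroup (Fin 2) ℂ) : Matrix (Fin 2) (Fin 2) ℂ)) +
          (((GaugeField.plaqHol W q : Matrix.specialUnitaryGroup (Fin 2) ℂ) : Matrix (Fin 2) (Fin 2) ℂ) -
            exp ((1 / ((F.P (K + 1)).L : ℝ) ^ 2) • curv V (blockOf q.src) q.μ q.ν))‖ := by congr 1; abel
      _ ≤ 4 * (C * η) + K₀ := (norm_add_le _ _).trans (add_le_add hA hB)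
      _ = K₀ + 4 * (C * η) := by ring
  have hB' : ∀ bd : PBond (F.P (K + 1)) 0, ‖((U' bd : Matrix.specialUnitaryGroup (Fin 2) ℂ) : Matrix (Fin 2) (Fin 2) ℂ) *
      star ((faceSec V bd : Matrix.specialUnitaryGroup (Fin 2) ℂ) : Matrix (Fin 2) (Fin 2) ℂ) - 1‖ ≤ 6 * a + C * η := fun bd => by
    have hA := h3 bd
    have hB := norm_interp_mul_star_faceSec_sub_one_le V ha1 hc2 bd
    rw [hd] at hB
    set u' := ((U' bd : Matrix.specialUnitaryGroup (Fin 2) ℂ) : Matrix (Fin 2) (Fin 2) ℂ)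
    set w := ((W bd : Matrix.specialUnitaryGroup (Fin 2) ℂ) : Matrix (Fin 2) (Fin 2) ℂ)
    set J := ((faceSec V bd : Matrix.specialUnitaryGroup (Fin 2) ℂ) : Matrix (Fin 2) (Fin 2) ℂ)
    have hsplit : u' * star J - 1 = (u' - w) * star J + (w * star J - 1) := by noncomm_ring
    rw [hsplit]
    calc ‖(u' - w) * star J + (w * star J - 1)‖ ≤ ‖(u' - w) * star J‖ + ‖w * star J - 1‖ := norm_add_le _ _
      _ ≤ ‖u' - w‖ * ‖star J‖ + 2 * 3 * a := add_le_add (norm_mul_le _ _) hB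
      _ ≤ C * η * 1 + 2 * 3 * a := by
          gcongr
          · rw [norm_star]; exact norm_coe_su2_le _
      _ = 6 * a + C * η := by ring
  refine ⟨U', ?_, ?_, ?_, ?_⟩
  · -- (i) exactness
    rw [descendTo_succ, blockAvg_avg]
    have h1' : avgFun (P := F.PP F.m (K + 1)) (j := 0) ℰp U' = fieldShift h10 U := h1
    rw [h1', fieldShift_fieldShift]
    exact fieldShift_refl _ _
  · -- (ii) plaquettes
    exact plaqSmall_of_le (by rw [ht]) h4
  · -- (iii) curvature gradients
    intro x ν κ κ' hκ
    have h := norm_covDerivT_plaqFT_le_of_structure hj V U' (a := a) (b' := 3 / 2 * b) (K := K₀ + 4 * (C * η)) (ε := 6 * a + C * η)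
      (by linarith) hK' hb' hc2 hcc hS' hB' x ν κ κ' hκ
    exact h
  · -- (iv) the action
    have hA := wilsonAction4_le_of_structure hj V U' (a := a) (K := K₀ + 4 * (C * η)) (by linarith) hK' hV' hS'
    have hAV : wilsonAction4 V = wilsonAction4 U := by rw [hV]; exact wilsonAction4_fieldShift h10 U
    have hcard : (Fintype.card (Plaq (F.P (K + 1)) 1) : ℝ) = 24 * (F.L : ℝ) ^ (3 * (F.m + K)) := by
      rw [B10Eq41TorusHistories.card_plaq_three rfl, Site.card_site]
      show ((3 * (2 * F.L ^ (F.m + (K + 1) - 1)) ^ 3 : ℕ) : ℝ) = _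
      rw [show F.m + (K + 1) - 1 = F.m + K by omega]
      push_cast
      ring
    have hpow : ((F.P (K + 1)).L : ℝ) ^ (F.P (K + 1)).d = (F.L : ℝ) ^ 3 := by rw [hPL]; rfl
    rw [hAV, hcard, hpow, hPL] at hA
    have hL3pos : (0 : ℝ) < (F.L : ℝ) ^ 3 := by positivity
    have key : (F.L : ℝ) ^ 3 * ((F.L : ℝ) * wilsonAction4 U') ≤ (F.L : ℝ) ^ 3 * (wilsonAction4 U + 24 * (F.L : ℝ) ^ (3 * (F.m + K)) *
        (16 * a ^ 3 + 2 * a * (F.L : ℝ) ^ 2 * (K₀ + 4 * (C * η)) + (4 * a ^ 2 + (F.L : ℝ) ^ 2 * (K₀ + 4 * (C * η))) ^ 2)) := by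
      calc (F.L : ℝ) ^ 3 * ((F.L : ℝ) * wilsonAction4 U') = (F.L : ℝ) ^ 4 * wilsonAction4 U' := by ring
        _ ≤ _ := hA
        _ = _ := by ring
    exact le_of_mul_le_mul_left key hL3pos

end Lift

/-! ## §4 The constants and the registered stub -/

section Stub

/-- Arithmetic of clause (ii): `5a + K₀ + 4Cη ≤ (1000 + 22000CL²)(a + b)`. [folklore] -/
theorem plaq_const_le {L C a b : ℝ} (hL : 1 ≤ L) (hC : 0 ≤ C) (hb : 0 ≤ b) (hba : b ≤ a) (ha : a ≤ 1 / 1400) :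
    5 * a + (392 * a ^ 2 + 27 / 2 * b) + 4 * (C * (1350 * L ^ 2 * a ^ 2 + 27 * b)) ≤ (1000 + 22000 * C * L ^ 2) * (a + b) := by
  have h1 : a ^ 2 ≤ a := by nlinarith
  have h2 : L ^ 2 * a ^ 2 ≤ L ^ 2 * a := mul_le_mul_of_nonneg_left h1 (by positivity)
  have hL2 : 1 ≤ L ^ 2 := by nlinarith
  nlinarith [mul_nonneg hC hb, mul_nonneg hC (hb.trans hba), mul_nonneg (mul_nonneg hC (hb.trans hba)) (by positivity : (0:ℝ) ≤ L ^ 2),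
    mul_nonneg (mul_nonneg hC hb) (by positivity : (0:ℝ) ≤ L ^ 2), mul_le_mul_of_nonneg_left h2 hC]

/-- Arithmetic of clause (iii): `2(K₀ + 4Cη) + 8a(6a + Cη) + (9/2)b ≤ (1000 + 22000CL²)(b + a²)`. [folklore] -/
theorem grad_const_le {L C a b : ℝ} (hL : 1 ≤ L) (hC : 0 ≤ C) (hb : 0 ≤ b) (hba : b ≤ a) (ha : a ≤ 1 / 1400) :
    2 * ((392 * a ^ 2 + 27 / 2 * b) + 4 * (C * (1350 * L ^ 2 * a ^ 2 + 27 * b))) +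
        8 * a * (6 * a + C * (1350 * L ^ 2 * a ^ 2 + 27 * b)) + 3 * (3 / 2 * b) ≤ (1000 + 22000 * C * L ^ 2) * (b + a ^ 2) := by
  have ha0 : 0 ≤ a := hb.trans hba
  have hL2 : 1 ≤ L ^ 2 := by nlinarith
  -- `8a·Cη ≤ 8Cη` and `η ≤ 1350L²a² + 27b`
  have hη0 : 0 ≤ C * (1350 * L ^ 2 * a ^ 2 + 27 * b) := by positivity
  have h1 : 8 * a * (C * (1350 * L ^ 2 * a ^ 2 + 27 * b)) ≤ 8 * (C * (1350 * L ^ 2 * a ^ 2 + 27 * b)) := by nlinarith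
  have h2 : C * b ≤ C * L ^ 2 * b := by nlinarith [mul_nonneg hC hb]
  have h3 : b ≤ L ^ 2 * b := by nlinarith
  nlinarith [mul_nonneg (mul_nonneg hC (sq_nonneg a)) (by positivity : (0:ℝ) ≤ L ^ 2), mul_nonneg hC hb, sq_nonneg a]

/-- Arithmetic of clause (iv): `24·(16a³ + 2aL²K′ + (4a² + L²K′)²) ≤ C₂·(b² + ab + a³)` with `K′ ≤ κ(a² + b)`, `κ = 400 + 5500CL²`,
`C₂ = 24(16 + 2L²κ + 2(4 + L²κ)²) + 12L²`. [folklore] -/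
theorem action_const_le {L C a b : ℝ} (hL : 1 ≤ L) (hC : 0 ≤ C) (hb : 0 ≤ b) (hba : b ≤ a) (ha : a ≤ 1 / 1400) :
    24 * (16 * a ^ 3 + 2 * a * L ^ 2 * ((392 * a ^ 2 + 27 / 2 * b) + 4 * (C * (1350 * L ^ 2 * a ^ 2 + 27 * b))) +
        (4 * a ^ 2 + L ^ 2 * ((392 * a ^ 2 + 27 / 2 * b) + 4 * (C * (1350 * L ^ 2 * a ^ 2 + 27 * b)))) ^ 2) ≤
      (24 * (16 + 2 * L ^ 2 * (400 + 5500 * C * L ^ 2) + 2 * (4 + L ^ 2 * (400 + 5500 * C * L ^ 2)) ^ 2) + 12 * L ^ 2) *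
        (b ^ 2 + a * b + a ^ 3) := by
  have ha0 : 0 ≤ a := hb.trans hba
  have ha1 : a ≤ 1 := by linarith
  have hL2 : 1 ≤ L ^ 2 := by nlinarith
  set κ : ℝ := 400 + 5500 * C * L ^ 2 with hκ
  have hκ0 : 0 ≤ κ := by positivity
  set K' : ℝ := (392 * a ^ 2 + 27 / 2 * b) + 4 * (C * (1350 * L ^ 2 * a ^ 2 + 27 * b)) with hK'
  have hK'0 : 0 ≤ K' := by positivity
  set s : ℝ := a ^ 2 + b with hs
  have hs0 : 0 ≤ s := by positivity
  -- `K′ ≤ κ s`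
  have hK's : K' ≤ κ * s := by
    rw [hK', hκ, hs]
    have h1 : C * b ≤ C * L ^ 2 * b := by nlinarith [mul_nonneg hC hb]
    nlinarith [mul_nonneg hC hb, mul_nonneg (mul_nonneg hC (sq_nonneg a)) (by positivity : (0:ℝ) ≤ L ^ 2), sq_nonneg a]
  -- the three terms
  have hs2 : s ^ 2 ≤ 2 * (a ^ 3 + b ^ 2) := by
    rw [hs]; have : a ^ 4 ≤ a ^ 3 := by nlinarith [pow_nonneg ha0 3]
    nlinarith [sq_nonneg (a ^ 2 - b)]
  have hT2 : 2 * a * L ^ 2 * K' ≤ 2 * L ^ 2 * κ * (a ^ 3 + a * b) := by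
    have := mul_le_mul_of_nonneg_left hK's (by positivity : (0:ℝ) ≤ 2 * a * L ^ 2)
    calc 2 * a * L ^ 2 * K' ≤ 2 * a * L ^ 2 * (κ * s) := this
      _ = 2 * L ^ 2 * κ * (a ^ 3 + a * b) := by rw [hs]; ring
  have hT3 : (4 * a ^ 2 + L ^ 2 * K') ^ 2 ≤ 2 * (4 + L ^ 2 * κ) ^ 2 * (a ^ 3 + b ^ 2) := by
    have h1 : 4 * a ^ 2 + L ^ 2 * K' ≤ (4 + L ^ 2 * κ) * s := by
      have := mul_le_mul_of_nonneg_left hK's (by positivity : (0:ℝ) ≤ L ^ 2)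
      rw [hs] at this ⊢; nlinarith
    have h0 : 0 ≤ 4 * a ^ 2 + L ^ 2 * K' := by positivity
    calc (4 * a ^ 2 + L ^ 2 * K') ^ 2 ≤ ((4 + L ^ 2 * κ) * s) ^ 2 := pow_le_pow_left₀ h0 h1 2
      _ = (4 + L ^ 2 * κ) ^ 2 * s ^ 2 := by ring
      _ ≤ (4 + L ^ 2 * κ) ^ 2 * (2 * (a ^ 3 + b ^ 2)) := by gcongr
      _ = _ := by ring
  have hE : 16 * a ^ 3 + 2 * a * L ^ 2 * K' + (4 * a ^ 2 + L ^ 2 * K') ^ 2 ≤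
      (16 + 2 * L ^ 2 * κ + 2 * (4 + L ^ 2 * κ) ^ 2) * (b ^ 2 + a * b + a ^ 3) := by
    have hab : 0 ≤ a * b := by positivity
    have ha3 : 0 ≤ a ^ 3 := by positivity
    have hb2 : 0 ≤ b ^ 2 := by positivity
    nlinarith [mul_nonneg (by positivity : (0:ℝ) ≤ 2 * L ^ 2 * κ) hb2, mul_nonneg (by positivity : (0:ℝ) ≤ 2 * (4 + L ^ 2 * κ) ^ 2) hab,
      mul_nonneg (by norm_num : (0:ℝ) ≤ 16) (add_nonneg hab hb2)]
  have hsum0 : 0 ≤ b ^ 2 + a * b + a ^ 3 := by positivity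
  nlinarith [mul_nonneg (by positivity : (0:ℝ) ≤ 12 * L ^ 2) hsum0]

/-- **THE REGISTERED STUB `stub_smoothLift` OF LINE `birth` (layer 4) — LOCATED GAP G-K1a-2′ — PROVED**: for every block size `L` there
are `C₁, C₂, c > 0` with `SmoothLiftAt L C₁ C₂ c` (`T3UpperLiftSplit`): smooth exact one-step lifts through Bałaban's averaging (0.4) with
the printed exp-mean-log operation on `SU(2)`, with plaquettes `< C₁(a+b)`, curvature gradients `≤ C₁(b + a²)` and
`L·A(U″) ≤ A(U) + C₂(b² + ab + a³)L^{3(m+K)}`.  Rough regime `a ≤ b`: the face section (`smoothLiftAt_of_smooth`); smooth regime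
`b < a`: the block-centred symmetric-gauge interpolation corrected to exactness (`exists_lift_raw`).  NOT PRINTED (abelian template
[King1986] (A.5)); not a claim of Bałaban's papers. [cite: King1986, (A.5) p.676; Balaban1987RG1, (0.4) p.253] -/
theorem stub_smoothLift : ∀ (L : ℕ), ∃ C₁ C₂ c : ℝ, 0 < C₁ ∧ 0 ≤ C₂ ∧ 0 < c ∧ SmoothLiftAt L C₁ C₂ c := by
  intro L
  obtain ⟨t₀, C, ht₀, hC, hcorr⟩ := exists_corrector_T3 L
  refine ⟨1000 + 22000 * C * (L : ℝ) ^ 2,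
    24 * (16 + 2 * (L : ℝ) ^ 2 * (400 + 5500 * C * (L : ℝ) ^ 2) + 2 * (4 + (L : ℝ) ^ 2 * (400 + 5500 * C * (L : ℝ) ^ 2)) ^ 2) + 12 * (L : ℝ) ^ 2,
    min (1 / (1400 * ((L : ℝ) ^ 2 + 1))) (t₀ / (500 + 1400 * C * ((L : ℝ) ^ 2 + 1))),
    by positivity, by positivity, lt_min (by positivity) (by positivity),
    smoothLiftAt_of_smooth L (by nlinarith [mul_nonneg hC (sq_nonneg (L : ℝ))]) (by
      have h0 : (0 : ℝ) ≤ 24 * (16 + 2 * (L : ℝ) ^ 2 * (400 + 5500 * C * (L : ℝ) ^ 2) +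
          2 * (4 + (L : ℝ) ^ 2 * (400 + 5500 * C * (L : ℝ) ^ 2)) ^ 2) := by positivity
      linarith) ?_⟩
  intro F hFL K a b hb hba hac U hU hgrad
  subst hFL
  have hL3 : (3 : ℝ) ≤ F.L := by
    have h1 := F.hL.2; obtain ⟨k, hk⟩ := F.hL.1
    have : 3 ≤ F.L := by omega
    exact_mod_cast this
  have hL1 : (1 : ℝ) ≤ F.L := by linarith
  have hapos : 0 < a := lt_of_le_of_lt hb hba
  obtain ⟨ha, ha', hat⟩ := stub_smallness hL1 hC hapos.le hac
  obtain ⟨U'', h1, h2, h3, h4⟩ := exists_lift_raw F K hC (hcorr F rfl (K + 1)) hb hba.le hapos ha hat U hU hgrad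
  refine ⟨U'', h1, plaqSmall_of_le (plaq_const_le hL1 hC hb hba.le ha') h2,
    fun x ν κ κ' hκ => (h3 x ν κ κ' hκ).trans (grad_const_le hL1 hC hb hba.le ha'), h4.trans ?_⟩
  have hpow : (0 : ℝ) ≤ (F.L : ℝ) ^ (3 * (F.m + K)) := by positivity
  have h := mul_le_mul_of_nonneg_left (action_const_le (L := (F.L : ℝ)) (C := C) hL1 hC hb hba.le ha') hpow
  linarith [h]

end Stub



end Summit.QuantumFields.YangMills.Theorems.SmoothLift

end
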